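import Literature.MathematicalPhysics.QuantumManyBody.PeriodicBoseGasThm21
import Literature.MathematicalPhysics.QuantumManyBody.PeriodicBoseGasBounded
import HarnessLib

/-!
# Fournais 2020, Theorem 2.1 on bounded states, from (2.43) on bounded states

Topic `Literature/MathematicalPhysics/QuantumManyBody` (provefacts
`Literature.MathematicalPhysics.QuantumManyBody.BoseGas.Fournais2020_lowerBound_Htilde` and
`…Fournais2020_condensation`, layer `Fournais2020_lemma24`). Third link of the bounded chain announced
in `PeriodicBoseGasBounded.lean` (`…Eq229Bdd → …Lemma24Bdd → …Eq243Bdd → …Thm21Bdd → …Eq317Bdd`):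

* `Fournais2020_thm21_bdd_of_eq243_bdd : Fournais2020_eq243_bdd → Fournais2020_thm21_bdd` — the small-box
  theorem [Fournais2020, Thm. 2.1 (2.11)] on **bounded** symmetric states of every sector follows
  from the `n`-particle bound [(2.43)–(2.46)] on bounded symmetric states by the particle-number
  bookkeeping of the printed proof ((2.12)–(2.14): groups of `⌈3ρ_μℓ³⌉` particles, interactions
  between groups dropped, (2.43) applied fibrewise to the slices `Z ↦ Φ(Z ⊔ Y)`; (2.47)–(2.50): the
  gap absorbs the `n₊`-terms, full groups are non-negative, the last group gives (2.11)), i.e. the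
  assembly `Fournais2020_thm21_of_eq243` of `PeriodicBoseGasThm21.lean` run verbatim — the only new
  point being that a slice of a bounded function is bounded by the same constant.

All the sectioning, grouping and real-arithmetic lemmas are those of `PeriodicBoseGasThm21.lean` and
`PeriodicBoseGasEq317.lean` (the slices `Z ↦ Φ(Z ⊔ Y)` along the splitting equivalence
`Λ^M ≃ Λ^{|S|} × Λ^{Sᶜ}` of those files enter only through `measurable_split_symm_left`,
`symm_split_symm_left` and `group_bound`). No new definitions, no notation.

## References

* [Fournais2020] S. Fournais, *Length scales for BEC in the dilute Bose gas*, arXiv:2011.00309,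
  EMS Ser. Congr. Rep. 18 (2021), doi:10.4171/ecr/18-1/7: Thm. 2.1, (2.11)–(2.14), (2.43)–(2.50).
* [BrietzkeFournaisSolovej2020] B. Brietzke, S. Fournais, J. P. Solovej, *A simple 2nd order
  lower bound to the energy of dilute Bose gases*, Comm. Math. Phys. 376 (2020) 323–351: Thm. 6.1.
-/

noncomputable section

open MeasureTheory Filter Set WithLp
open scoped ENNReal NNReal Topology

namespace Literature.MathematicalPhysics.QuantumManyBody.BoseGas

variable {χ : Space → ℝ} {v : ℝ → ℝ≥0∞} {ω : Space → ℝ}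

/-- **Fournais 2020, Theorem 2.1 on bounded states, from the `n`-particle bound (2.43) on bounded
states.** Verbatim the assembly `Fournais2020_thm21_of_eq243` (`PeriodicBoseGasThm21.lean`): with
`Ξ = 3`, `K₀ = max(1, (12C/b)^{1/2})` and `ρ_μa³ ≤ min(K⁻⁶, (c₁/(RK))²a², C₀⁻², 1)`, the `M` particles
are divided into groups of `m = ⌈3ρ_μℓ³⌉ ≤ 4ρ_μℓ³` and a last group of fewer (2.12)–(2.13), the
interaction between the groups is dropped (2.14), and (2.43) is applied fibrewise to the slices
`Z ↦ Φ(Z ⊔ Y)` of the (bounded, symmetric) state — which are bounded by the bound of `Φ` and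
symmetric; each full group contributes `≥ 0` (2.50), the last one
`≥ -4πaρ_μ²ℓ³(1 + C₀(ρ_μa³)^{1/2})` (2.49), (2.47), `C₀ = CK³(105 + 20(R/a)²)/(4π)`.
[cite: Fournais2020, Thm. 2.1, (2.11)–(2.14), (2.43)–(2.50)] -/
theorem Fournais2020_thm21_bdd_of_eq243_bdd (h243 : Fournais2020_eq243_bdd) : Fournais2020_thm21_bdd := by
  intro v hv hint ha ω hω χ hχ b s hb hs
  obtain ⟨hvmeas, R₀, hR₀⟩ := hv
  have ha0 : 0 < (scatteringLength v).toReal := scatteringLength_toReal_pos hint ha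
  set R : ℝ := max R₀ 0 + 1 with hRdef
  have hRpos : 0 < R := by have := le_max_right R₀ 0; linarith
  have hR : ∀ r, R < r → v r = 0 := fun r hr => hR₀ r (by have := le_max_left R₀ 0; linarith)
  obtain ⟨C, c₁, hC, hc₁, H⟩ := h243 v ⟨hvmeas, R₀, hR₀⟩ hint ha ω hω χ hχ b s hb hs R hRpos hR
  -- `K₀ ≥ 1` with `bK₀² ≥ 12C`
  set K₀ : ℝ := max 1 (Real.sqrt (12 * C / b)) with hK₀def
  have hK₀1 : 1 ≤ K₀ := le_max_left _ _
  refine ⟨K₀, by linarith, fun K hK => ?_⟩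
  have hK1 : 1 ≤ K := hK₀1.trans hK
  have hKpos : 0 < K := by linarith
  have hKb : 12 * C ≤ b * K ^ 2 := by
    have h1 : Real.sqrt (12 * C / b) ≤ K := (le_max_right _ _).trans hK
    have h2 : 12 * C / b ≤ K ^ 2 := by
      have h3 := Real.sq_sqrt (by positivity : 0 ≤ 12 * C / b)
      nlinarith [Real.sqrt_nonneg (12 * C / b)]
    rw [div_le_iff₀ hb] at h2
    linarith
  set a : ℝ := (scatteringLength v).toReal with hadef
  set C₀ : ℝ := C * K ^ 3 * (105 + 20 * (R / a) ^ 2) / (4 * Real.pi) with hC₀def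
  have hC₀ : 0 < C₀ := by positivity
  set c : ℝ := min (min (K ^ 6)⁻¹ ((c₁ / (R * K)) ^ 2 * a ^ 2)) (min (C₀ ^ 2)⁻¹ 1) with hcdef
  have hc : 0 < c := by positivity
  refine ⟨C₀, c, hC₀, hc, ?_⟩
  intro ρμ hρμ
  dsimp only
  intro hρc M u Φ hΦm hΦb hΦs
  set ℓ : ℝ := boxLength K ρμ a with hℓdef
  -- the regime
  have hρc1 : ρμ * a ^ 3 ≤ (K ^ 6)⁻¹ := hρc.trans ((min_le_left _ _).trans (min_le_left _ _))
  have hρc2 : ρμ * a ^ 3 ≤ (c₁ / (R * K)) ^ 2 * a ^ 2 :=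
    hρc.trans ((min_le_left _ _).trans (min_le_right _ _))
  have hρc3 : ρμ * a ^ 3 ≤ (C₀ ^ 2)⁻¹ := hρc.trans ((min_le_right _ _).trans (min_le_left _ _))
  have hρc4 : ρμ * a ^ 3 ≤ 1 := hρc.trans ((min_le_right _ _).trans (min_le_right _ _))
  have hsq : 0 < Real.sqrt (ρμ * a) := Real.sqrt_pos.2 (by positivity)
  have hℓ0 : 0 < ℓ := by rw [hℓdef, boxLength]; positivity
  have hℓ2 : (ℓ ^ 2)⁻¹ = K ^ 2 * (ρμ * a) := boxLength_sq_inv hρμ ha0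
  have hρℓ3 : ρμ * ℓ ^ 3 = (K ^ 3 * Real.sqrt (ρμ * a ^ 3))⁻¹ := rho_mul_boxLength_cube hKpos hρμ ha0
  have hsqrt_pos : 0 < Real.sqrt (ρμ * a ^ 3) := Real.sqrt_pos.2 (by positivity)
  have hsq1 : Real.sqrt (ρμ * a ^ 3) ≤ 1 := Real.sqrt_le_one.mpr hρc4
  have hρℓ : 1 ≤ ρμ * ℓ ^ 3 := by
    rw [hρℓ3, one_le_inv_iff₀]
    refine ⟨by positivity, ?_⟩
    have h1 : Real.sqrt (ρμ * a ^ 3) ≤ (K ^ 3)⁻¹ := by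
      rw [← Real.sqrt_sq (by positivity : 0 ≤ (K ^ 3)⁻¹)]
      exact Real.sqrt_le_sqrt (by rw [inv_pow, ← pow_mul]; exact hρc1)
    calc K ^ 3 * Real.sqrt (ρμ * a ^ 3) ≤ K ^ 3 * (K ^ 3)⁻¹ := by gcongr
      _ = 1 := mul_inv_cancel₀ (by positivity)
  have hRℓ : R ≤ c₁ * ℓ := by
    have h1 : ρμ * a ≤ (c₁ / (R * K)) ^ 2 := by
      have h3 : ρμ * a * a ^ 2 ≤ (c₁ / (R * K)) ^ 2 * a ^ 2 := by nlinarith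
      exact le_of_mul_le_mul_right h3 (by positivity)
    have h4 : Real.sqrt (ρμ * a) ≤ c₁ / (R * K) := by
      rw [← Real.sqrt_sq (by positivity : 0 ≤ c₁ / (R * K))]
      exact Real.sqrt_le_sqrt h1
    rw [hℓdef, boxLength]
    rw [← div_le_iff₀' hc₁, le_inv_comm₀ (by positivity) (by positivity)]
    calc K * Real.sqrt (ρμ * a) ≤ K * (c₁ / (R * K)) := by gcongr
      _ = (R / c₁)⁻¹ := by field_simp
  have haρ : a * ρμ = K ^ 3 * (ρμ ^ 2 * a * ℓ ^ 3) * Real.sqrt (ρμ * a ^ 3) :=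
    a_mul_rho_eq hKpos hρμ ha0
  have hρℓR : ρμ * ℓ * R ^ 2 = R ^ 2 * Real.sqrt (ρμ * a ^ 3) / (K * a ^ 2) :=
    rho_mul_boxLength_mul_sq hKpos hρμ ha0 R
  have hC₀sq : C₀ * Real.sqrt (ρμ * a ^ 3) ≤ 1 := by
    have h1 : Real.sqrt (ρμ * a ^ 3) ≤ C₀⁻¹ := by
      rw [← Real.sqrt_sq (by positivity : 0 ≤ C₀⁻¹)]
      exact Real.sqrt_le_sqrt (by rw [inv_pow]; exact hρc3)
    calc C₀ * Real.sqrt (ρμ * a ^ 3) ≤ C₀ * C₀⁻¹ := by gcongr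
      _ = 1 := mul_inv_cancel₀ hC₀.ne'
  -- the constant of (2.11) and the error bound (2.47)
  set Bl : ℝ := 4 * Real.pi * ρμ ^ 2 * a * ℓ ^ 3 * (1 + C₀ * (ρμ * a ^ 3) ^ (1 / 2 : ℝ)) with hBldef
  have hBl_eq : 4 * Real.pi * a * ρμ ^ 2 * ℓ ^ 3 + C * (105 + 20 * (R / a) ^ 2) * (a * ρμ) = Bl := by
    rw [hBldef, ← Real.sqrt_eq_rpow, haρ, hC₀def]
    field_simp
  have hBl_eq' : 4 * Real.pi * a * ρμ ^ 2 * ℓ ^ 3 * (1 + C₀ * Real.sqrt (ρμ * a ^ 3)) = Bl := by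
    rw [hBldef, ← Real.sqrt_eq_rpow]; ring
  have hE : ∀ n : ℕ, (n : ℝ) ≤ 4 * (ρμ * ℓ ^ 3) →
      4 * Real.pi * a * ρμ ^ 2 * ℓ ^ 3 +
          C * n * a / ℓ ^ 3 * (1 + a ^ 2 * (n + 1) ^ 2 / ℓ ^ 2 + (n + 1) * R ^ 2 / ℓ ^ 2) + C * a * ρμ ≤ Bl :=
    fun n hn => (error_bound hC.le ha0 hρμ hℓ0 hK1 hℓ2 hρℓ hρℓR hsq1 hn).trans hBl_eq.le
  have hgap : ∀ n : ℕ, (n : ℝ) ≤ 4 * (ρμ * ℓ ^ 3) → C * a * ((n + 1) / ℓ ^ 3 + ρμ) ≤ b / ℓ ^ 2 :=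
    fun n hn => gap_bound hC.le ha0 hρμ hℓ0 hℓ2 hρℓ hKb hn
  have hfullsq : ∀ n : ℕ, 3 * (ρμ * ℓ ^ 3) ≤ n → Bl ≤ 2 * Real.pi * (a / ℓ ^ 3) * (ρμ * ℓ ^ 3 - n) ^ 2 :=
    fun n hn => hBl_eq'.symm.le.trans (full_bound ha0.le hρμ.le hℓ0 hn hC₀sq)
  -- (2.43) on the sectors of the box `Λ(u)`
  have HΦ : ∀ (n : ℕ) (Φ' : Config n → ℂ), Measurable Φ' → (∃ M' : ℝ, ∀ X, ‖Φ' X‖ ≤ M') →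
      (∀ (σ : Equiv.Perm (Fin n)) (X : Config n), Φ' (X ∘ σ) = Φ' X) →
      (∫⁻ X in boxConfig n ℓ u, attrBoxN v ω χ ℓ ρμ u X * (‖Φ' X‖₊ : ℝ≥0∞) ^ 2) +
          ENNReal.ofReal (2 * Real.pi * (a / ℓ ^ 3) * (ρμ * ℓ ^ 3 - n) ^ 2) *
            (∫⁻ X in boxConfig n ℓ u, (‖Φ' X‖₊ : ℝ≥0∞) ^ 2) +
          ENNReal.ofReal (b / ℓ ^ 2) * nPlusBoxN ℓ u Φ' ≤
        kinBoxN χ ℓ s b u Φ' +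
          (∫⁻ X in boxConfig n ℓ u, repBoxN v χ ℓ u X * (‖Φ' X‖₊ : ℝ≥0∞) ^ 2) +
          ENNReal.ofReal (C * a * ((n + 1) / ℓ ^ 3 + ρμ)) * nPlusBoxN ℓ u Φ' +
          ENNReal.ofReal (4 * Real.pi * a * ρμ ^ 2 * ℓ ^ 3 +
              C * n * a / ℓ ^ 3 * (1 + a ^ 2 * (n + 1) ^ 2 / ℓ ^ 2 + (n + 1) * R ^ 2 / ℓ ^ 2) +
              C * a * ρμ) *
            ∫⁻ X in boxConfig n ℓ u, (‖Φ' X‖₊ : ℝ≥0∞) ^ 2 :=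
    fun n Φ' h1 hb' h2 => H ℓ ρμ hℓ0 hρμ hRℓ n u Φ' h1 hb' h2
  -- states of infinite norm
  have hnorm : Measurable fun X : Config M => (‖Φ X‖₊ : ℝ≥0∞) ^ 2 :=
    (hΦm.nnnorm.coe_nnreal_ennreal).pow_const _
  have hBlpos : 0 < Bl := by
    rw [← hBl_eq']
    have : 0 ≤ C₀ * Real.sqrt (ρμ * a ^ 3) := by positivity
    positivity
  by_cases hΦ2 : (∫⁻ X in boxConfig M ℓ u, (‖Φ X‖₊ : ℝ≥0∞) ^ 2) = ⊤
  · rw [hΦ2, ENNReal.mul_top (by rwa [Ne, ENNReal.ofReal_eq_zero, not_le]), add_top]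
    exact le_top
  -- the grouping (2.12)–(2.13): `m = ⌈3ρ_μℓ³⌉ ∈ [3ρ_μℓ³, 4ρ_μℓ³]`, `M = mq + r`, `r < m`
  set m : ℕ := ⌈3 * (ρμ * ℓ ^ 3)⌉₊ with hmdef
  have hm3 : 3 * (ρμ * ℓ ^ 3) ≤ m := Nat.le_ceil _
  have hm4 : (m : ℝ) ≤ 4 * (ρμ * ℓ ^ 3) := by
    have := Nat.ceil_lt_add_one (by positivity : 0 ≤ 3 * (ρμ * ℓ ^ 3))
    rw [← hmdef] at this
    linarith
  have hmpos : 0 < m := by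
    have : (0 : ℝ) < m := by linarith
    exact_mod_cast this
  set q : ℕ := M / m with hqdef
  set r : ℕ := M % m with hrdef
  have hMmr : m * q + r = M := Nat.div_add_mod M m
  have hr : r < m := Nat.mod_lt _ hmpos
  have hr4 : (r : ℝ) ≤ 4 * (ρμ * ℓ ^ 3) := by
    have : (r : ℝ) ≤ m := by exact_mod_cast hr.le
    linarith
  let e : Fin M ≃ (Fin m × Fin q) ⊕ Fin r :=
    (finCongr hMmr.symm).trans (finSumFinEquiv.symm.trans (Equiv.sumCongr finProdFinEquiv.symm (Equiv.refl _)))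
  -- the bounds on the groups
  have hfull : ∀ t : Fin q,
      (∫⁻ X in boxConfig M ℓ u,
        (ENNReal.ofReal ρμ * ∑ i ∈ Finset.univ.image (fun j : Fin m => e.symm (Sum.inl (j, t))),
          ∫⁻ y, pairLoc₁ v ω χ ℓ u (X i) y) * (‖Φ X‖₊ : ℝ≥0∞) ^ 2) ≤
      (∑ i ∈ Finset.univ.image (fun j : Fin m => e.symm (Sum.inl (j, t))), (ENNReal.ofReal ℓ ^ 3)⁻¹ *
          ∫⁻ X in boxConfig M ℓ u, kinLoc χ ℓ s b u fun x => Φ (Function.update X i x)) +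
        (∫⁻ X in boxConfig M ℓ u,
          (∑ i ∈ Finset.univ.image (fun j : Fin m => e.symm (Sum.inl (j, t))),
            ∑ i' ∈ Finset.univ.image (fun j : Fin m => e.symm (Sum.inl (j, t))) with i < i',
              pairLoc v χ ℓ u (X i) (X i')) * (‖Φ X‖₊ : ℝ≥0∞) ^ 2) +
        0 * ∫⁻ X in boxConfig M ℓ u, (‖Φ X‖₊ : ℝ≥0∞) ^ 2 := by
    intro t
    set S := Finset.univ.image (fun j : Fin m => e.symm (Sum.inl (j, t))) with hSdef
    have hcard : S.card = m := card_group e t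
    refine group_bound hvmeas hω.measurable hχ ℓ ρμ s b u hΦm S 0 hΦ2 fun Y hY => ?_
    have h := HΦ S.card _ (measurable_split_symm_left S hΦm Y) (hΦb.imp fun _ hM Z => hM _)
      (symm_split_symm_left S hΦs Y)
    rw [zero_mul, add_zero]
    have hn4 : (S.card : ℝ) ≤ 4 * (ρμ * ℓ ^ 3) := by rw [hcard]; exact hm4
    have hn3 : 3 * (ρμ * ℓ ^ 3) ≤ S.card := by rw [hcard]; exact hm3
    exact sector_bound_full h (hgap _ hn4) (nPlusBoxN_le_kinBoxN χ ℓ s b u _)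
      ((hE _ hn4).trans (hfullsq _ hn3)) hY
  have hlast :
      (∫⁻ X in boxConfig M ℓ u,
        (ENNReal.ofReal ρμ * ∑ i ∈ Finset.univ.image (fun j : Fin r => e.symm (Sum.inr j)),
          ∫⁻ y, pairLoc₁ v ω χ ℓ u (X i) y) * (‖Φ X‖₊ : ℝ≥0∞) ^ 2) ≤
      (∑ i ∈ Finset.univ.image (fun j : Fin r => e.symm (Sum.inr j)), (ENNReal.ofReal ℓ ^ 3)⁻¹ *
          ∫⁻ X in boxConfig M ℓ u, kinLoc χ ℓ s b u fun x => Φ (Function.update X i x)) +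
        (∫⁻ X in boxConfig M ℓ u,
          (∑ i ∈ Finset.univ.image (fun j : Fin r => e.symm (Sum.inr j)),
            ∑ i' ∈ Finset.univ.image (fun j : Fin r => e.symm (Sum.inr j)) with i < i',
              pairLoc v χ ℓ u (X i) (X i')) * (‖Φ X‖₊ : ℝ≥0∞) ^ 2) +
        ENNReal.ofReal Bl * ∫⁻ X in boxConfig M ℓ u, (‖Φ X‖₊ : ℝ≥0∞) ^ 2 := by
    set S := Finset.univ.image (fun j : Fin r => e.symm (Sum.inr j)) with hSdef
    have hcard : S.card = r := card_group_last e
    refine group_bound hvmeas hω.measurable hχ ℓ ρμ s b u hΦm S (ENNReal.ofReal Bl) hΦ2 fun Y _ => ?_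
    have h := HΦ S.card _ (measurable_split_symm_left S hΦm Y) (hΦb.imp fun _ hM Z => hM _)
      (symm_split_symm_left S hΦs Y)
    have hn4 : (S.card : ℝ) ≤ 4 * (ρμ * ℓ ^ 3) := by rw [hcard]; exact hr4
    refine (sector_bound_last h (hgap _ hn4) (nPlusBoxN_le_kinBoxN χ ℓ s b u _)).trans ?_
    gcongr
    exact hE _ hn4
  -- summing over the groups (2.14)
  have hsum := add_le_add (Finset.sum_le_sum fun t (_ : t ∈ (Finset.univ : Finset (Fin q))) => hfull t) hlast
  rw [← lintegral_attr_groups hvmeas hω.measurable hχ ℓ ρμ u hΦm e] at hsum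
  refine hsum.trans ?_
  simp only [zero_mul, add_zero, Finset.sum_add_distrib]
  have hkin : (∑ t : Fin q, ∑ i ∈ Finset.univ.image (fun j : Fin m => e.symm (Sum.inl (j, t))),
        (ENNReal.ofReal ℓ ^ 3)⁻¹ * ∫⁻ X in boxConfig M ℓ u, kinLoc χ ℓ s b u fun x => Φ (Function.update X i x)) +
      (∑ i ∈ Finset.univ.image (fun j : Fin r => e.symm (Sum.inr j)),
        (ENNReal.ofReal ℓ ^ 3)⁻¹ * ∫⁻ X in boxConfig M ℓ u, kinLoc χ ℓ s b u fun x => Φ (Function.update X i x)) =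
      kinBoxN χ ℓ s b u Φ := by
    unfold kinBoxN
    exact (sum_eq_sum_groups e _).symm
  have hrep := sum_lintegral_rep_groups_le hvmeas hχ ℓ u hΦm e
  calc _ = ((∑ t : Fin q, ∑ i ∈ Finset.univ.image (fun j : Fin m => e.symm (Sum.inl (j, t))),
          (ENNReal.ofReal ℓ ^ 3)⁻¹ * ∫⁻ X in boxConfig M ℓ u, kinLoc χ ℓ s b u fun x => Φ (Function.update X i x)) +
        ∑ i ∈ Finset.univ.image (fun j : Fin r => e.symm (Sum.inr j)),
          (ENNReal.ofReal ℓ ^ 3)⁻¹ * ∫⁻ X in boxConfig M ℓ u, kinLoc χ ℓ s b u fun x => Φ (Function.update X i x)) +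
        ((∑ t : Fin q, ∫⁻ X in boxConfig M ℓ u,
          (∑ i ∈ Finset.univ.image (fun j : Fin m => e.symm (Sum.inl (j, t))),
            ∑ i' ∈ Finset.univ.image (fun j : Fin m => e.symm (Sum.inl (j, t))) with i < i',
              pairLoc v χ ℓ u (X i) (X i')) * (‖Φ X‖₊ : ℝ≥0∞) ^ 2) +
          ∫⁻ X in boxConfig M ℓ u,
            (∑ i ∈ Finset.univ.image (fun j : Fin r => e.symm (Sum.inr j)),
              ∑ i' ∈ Finset.univ.image (fun j : Fin r => e.symm (Sum.inr j)) with i < i',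
                pairLoc v χ ℓ u (X i) (X i')) * (‖Φ X‖₊ : ℝ≥0∞) ^ 2) +
        ENNReal.ofReal Bl * ∫⁻ X in boxConfig M ℓ u, (‖Φ X‖₊ : ℝ≥0∞) ^ 2 := by ring
    _ ≤ kinBoxN χ ℓ s b u Φ +
        (∫⁻ X in boxConfig M ℓ u, repBoxN v χ ℓ u X * (‖Φ X‖₊ : ℝ≥0∞) ^ 2) +
        ENNReal.ofReal Bl * ∫⁻ X in boxConfig M ℓ u, (‖Φ X‖₊ : ℝ≥0∞) ^ 2 := by
        rw [hkin]
        gcongr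


end Literature.MathematicalPhysics.QuantumManyBody.BoseGas

end
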